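import Literature.AnabelianGeometry.AbsoluteAnabelian.AbsTopII.EllipticCuspidalizationComparisonPrime
import Literature.AnabelianGeometry.AbsoluteAnabelian.AbsTopII.EllipticCuspidalizationContent
import HarnessLib

/-!
# [AbsTopII] Cor 3.3 (iii) over the datum WITH the content of (a): `Cor_3_3_iii″`

S. Mochizuki, *Topics in Absolute Anabelian Geometry II* [AbsTopII] (bib `MochizukiAbsTopII2013`;
kurims manuscript `paper:url-585b8d0ad0d9`), §3, Cor 3.3 (iii) pp. 68–69: "(a) There exists a [not
necessarily unique] `Π`-chain, which admits an entirely 'group-theoretic' description, with associated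
type-chain `⋏, ⋎, ⋏, •, …, •, ⋏, ⋎` — cf. Example 3.2, (ii) — that admits a terminal isomorphism with
the trivial `Π`-chain [of length `0`], and whose final three groups consist of `Π_D ⇝ Π_V ⇝ Π` such
that the natural surjection `Π_U ↠ Π_D` may be recovered from the chain of “•’s” terminating at the
third to last group".

Statements file (ONE predicate), abc-iut rows «COR33-RETYPE» (seat abc-iut-L4-t4; the datum-internal
retyping `EllipticDatumModel.Cor_3_3_i′/ii′/iii′`, `EllipticCuspidalizationComparisonPrime.lean`) and
«COR33-CHAIN-CONTENT» (abc-iut-L4-t6; the chain-content predicate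
`EllipticCuspidalization.RealizesChain`, `EllipticCuspidalizationContent.lean`), conjoined as ruled by
abc-iut-L4-lead (RULING #6q): **`EllipticDatumModel.Cor_3_3_iii″`** = `Cor_3_3_iii′` with its chain
clause `HasProSigmaTerminalChainOfType …` (type-chain and `Π_V` of SOME pro-`Σ` chain) replaced by
`K.RealizesChain …` (a pro-`Σ` chain of that type whose •-block COMPUTES the output's `Π_U ↠ Π_D` and
whose last three terms are `Π_D ⇝ Π_V ⇝ Π`).  Supersedes `Cor_3_3_iii′` for consumers; the proof-only
link `cor_3_3_iii′_of_cor_3_3_iii″` is the companion's (via abc-iut-L4-t6's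
`RealizesChain.hasProSigmaTerminalChainOfType`).
HONEST FRAMING: a predicate on a MODEL INTERFACE the tree does not instantiate; typed ≠ proved;
nothing here bears on [IUTchIII] Cor 3.12.
-/

noncomputable section

open CategoryTheory Topology
open scoped Pointwise

universe u

namespace Literature.AnabelianGeometry.AbsoluteAnabelian.AbsTopII

open Literature.AlgebraicGeometry.Frobenioids (IsSlimGroup)
open FundamentalExtension
open AbsTopI (ConstructionDataClass)

namespace EllipticDatumModel

variable {𝒟 : ConstructionDataClass.{u}} (M : EllipticDatumModel 𝒟)

/-- **Corollary 3.3 (iii″)** pp. 68–69 relative to the datum, WITH THE CONTENT OF (a): as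
`Cor_3_3_iii′` (for every datum core `f : X → C`, every `N`, some open `G₀ ⊆ G`, every setting `s`
with this `N` and `G' ⊆ G₀`, an `EllipticCuspidalization` matching `s` — core `Π_C`, `Π_D`, `Π_V`,
output `Π_{U_X} ↠ Π` = `[π₁]` of a datum open immersion with the cusps clause (c)), AND "(a) there
exists a `Π`-chain [...] with associated type-chain `⋏, ⋎, ⋏, •, …, •, ⋏, ⋎` [...] that admits a
terminal isomorphism with the trivial `Π`-chain [...] whose final three groups consist of
`Π_D ⇝ Π_V ⇝ Π` such that the natural surjection `Π_U ↠ Π_D` may be recovered from the chain of •’s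
terminating at the third to last group" (abc-iut-L4-t6's `EllipticCuspidalization.RealizesChain`).
[cite: MochizukiAbsTopII2013, Cor 3.3 (iii) pp.68-69] -/
def Cor_3_3_iii'' : Prop :=
  𝒟.IsChainFull → 𝒟.RelIsomDGC →
    ∀ (b : 𝒟.Base) (X : (𝒟.datum b).Obj) (h : M.IsCor33Member b X) (C : (𝒟.datum b).Obj)
      (f : (𝒟.datum b).Hom X C), M.IsFinEt f → M.IsCoreOf b C X → ∀ N : ℕ,
      ∃ G₀ : Subgroup ((𝒟.datum b).ext X).gal, IsOpen (G₀ : Set ((𝒟.datum b).ext X).gal) ∧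
        ∀ s : M.Setting b X C f, s.level = N → s.galOpen ≤ G₀ →
          ∃ K : EllipticCuspidalization ((𝒟.datum b).ext X), M.Matches s K ∧
            K.RealizesChain (𝒟.datum b).primes (M.cusps b X)
              (((𝒟.datum b).ext X).arith_slim_of_geom_slim_of_gal_slim h.geom_slim h.slim)
              h.geom_slim h.geom_ne_bot

end EllipticDatumModel

end Literature.AnabelianGeometry.AbsoluteAnabelian.AbsTopII

end
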